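import Literature.AlgebraicGeometry.Morphisms.CechH1Projective
import Literature.AlgebraicGeometry.Motives.CartierDivisorExtension
import Literature.AlgebraicGeometry.Motives.HypersurfaceChartAlgebra
import HarnessLib

/-!
# Degree-zero fractions on a closed subscheme of `𝐏^r_A` as rational functions

For a commutative ring `A`, `𝐏 = 𝐏^r_A = Proj A[x₀, …, x_r]` (`ProjCech.PP`,
`Literature/AlgebraicGeometry/Morphisms/CechH1Projective`) and a morphism `ι : Z → 𝐏` (a closed
immersion where stated) from an INTEGRAL scheme `Z`, this file sets up the calculus of rational
functions on `Z` coming from homogeneous polynomials, for ARBITRARY homogeneous denominators `H`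
of positive degree (the sibling `CechH1Projective` treats the monomials `X_s` only):

* `ProjFrac.ZH ι H = ι⁻¹ D₊(H)` — affine for `ι` affine (`isAffineOpen_ZH`), multiplicative in `H`;
* `ProjFrac.evalAway ι H : (A[x]_{(H)})₀ →+* Γ(Z, Z_H)` (Mathlib `Proj.awayToSection` then `ι^*`),
  natural in `H ∣ H'` (`map_evalAway_eq_evalAway_awayMap`) and surjective for a closed immersion
  (`evalAway_surjective`);
* `ProjFrac.fracFn ι H : (A[x]_{(H)})₀ →+* K(Z)` for `Z_H ≠ ∅` — **the rational function of a
  degree-zero fraction `G/H^m`** (germ of `evalAway` at the generic point), independent of the chart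
  (`fracFn_awayMap`), regular on `Z_H` (`isRegularAt_fracFn`); conversely every rational function
  regular on `Z_H` is such a fraction when `ι` is a closed immersion
  (`exists_fracFn_eq_of_forall_isRegularAt`: `Γ(Z_H, 𝒪_Z) = (A[x]/I_Z)_{(H)}` read in `K(Z)`);
* `ProjFrac.isUnitAt_fracFn_isLocalizationElem` — on `Z_{HG} = Z_H ∩ Z_G` the fraction
  `G^{deg H}/H^{deg G}` is a unit (Mathlib `Proj.awayι_preimage_basicOpen`).

Everything is proved; no named facts. This is the function-field dictionary behind the comparison of
the Čech complex of a line bundle on `Z` for a cover by basic opens `Z_{H_c}` with the algebraic Čech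
complex of a graded module (Serre, FAC n° 66; Hartshorne III.5). Mathlib searched (pin):
`Proj.awayToSection`, `Proj.basicOpenIsoAway`, `Proj.awayMap_awayToSection`,
`Proj.awayι_preimage_basicOpen`, `Proj.isAffineOpen_basicOpen`, `Scheme.Hom.app_surjective`,
`HomogeneousLocalization.Away.isLocalizationElem` (used).

## References

* R. Hartshorne, *Algebraic Geometry*, GTM 52 (1977): II Prop. 2.5 (b), II Prop. 5.9, III Thm. 5.2.
  [Hartshorne1977]
* J.-P. Serre, *Faisceaux algébriques cohérents*, Ann. of Math. 61 (1955), n° 66.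
-/

noncomputable section

open CategoryTheory AlgebraicGeometry TopologicalSpace Opposite HomogeneousLocalization
open Literature.Algebra.Homology.LaurentCech Literature.AlgebraicGeometry.Morphisms
open Literature.AlgebraicGeometry.Morphisms.ProjCech
open Literature.AlgebraicGeometry.Motives.RatFn

universe u

attribute [local instance] MvPolynomial.gradedAlgebra
  Literature.AlgebraicGeometry.Motives.ProjBaseChange.algebraBase

namespace Literature.AlgebraicGeometry.Motives

namespace ProjFrac

variable {A : Type u} [CommRing A] {r : ℕ} {Z : Scheme.{u}} (ι : Z ⟶ PP A r)

/-! ### The opens `Z_H = ι⁻¹ D₊(H)` -/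

/-- The open `Z_H = ι⁻¹ D₊(H)` of `Z` for a polynomial `H`. [folklore] -/
abbrev ZH (H : MvPolynomial (Fin (r + 1)) A) : Z.Opens := ι ⁻¹ᵁ Proj.basicOpen (grading A r) H

/-- `Z_{HG} = Z_H ∩ Z_G`. [folklore] -/
theorem ZH_mul (H G : MvPolynomial (Fin (r + 1)) A) : ZH ι (H * G) = ZH ι H ⊓ ZH ι G := by
  rw [ZH, Proj.basicOpen_mul]; rfl

/-- `Z_{H'} ⊆ Z_H` for `H ∣ H'`. [folklore] -/
theorem ZH_mono {H H' : MvPolynomial (Fin (r + 1)) A} (h : H ∣ H') : ZH ι H' ≤ ZH ι H :=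
  Scheme.Hom.preimage_mono _ (Proj.basicOpen_mono _ _ _ h)

/-- `Z_{H^n} = Z_H` for `n > 0`. [folklore] -/
theorem ZH_pow (H : MvPolynomial (Fin (r + 1)) A) {n : ℕ} (hn : 0 < n) : ZH ι (H ^ n) = ZH ι H := by
  rw [ZH, Proj.basicOpen_pow _ _ _ hn]

/-- `Z_H` is affine for `ι` an affine morphism and `H` homogeneous of positive degree. [folklore] -/
theorem isAffineOpen_ZH [IsAffineHom ι] {m : ℕ} {H : MvPolynomial (Fin (r + 1)) A}
    (hH : H ∈ grading A r m) (hm : 0 < m) : IsAffineOpen (ZH ι H) :=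
  (Proj.isAffineOpen_basicOpen _ _ hH hm).preimage ι

/-! ### Evaluation of degree-zero fractions on `Z` -/

/-- **The evaluation ring homomorphism `(A[x]_{(H)})₀ → Γ(Z, Z_H)`**: Mathlib's
`Proj.awayToSection` followed by pull-back along `ι`. [folklore] -/
def evalAway (H : MvPolynomial (Fin (r + 1)) A) :
    Away (grading A r) H →+* Γ(Z, ZH ι H) :=
  (ι.app (Proj.basicOpen (grading A r) H)).hom.comp (Proj.awayToSection (grading A r) H).hom

/-- `evalAway` unfolded. [folklore] -/
theorem evalAway_apply (H : MvPolynomial (Fin (r + 1)) A) (a : Away (grading A r) H) :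
    evalAway ι H a = ι.app _ (Proj.awayToSection (grading A r) H a) := rfl

/-- **Naturality of `evalAway` in the denominator**: for `H' = H G` with `G` homogeneous,
`evalAway H' (awayMap a) = (evalAway H a)|_{Z_{H'}}`. [folklore] -/
theorem evalAway_awayMap {H G H' : MvPolynomial (Fin (r + 1)) A} {m' : ℕ} (hG : G ∈ grading A r m')
    (hx : H' = H * G) (a : Away (grading A r) H) :
    evalAway ι H' (awayMap (grading A r) hG hx a) =
      Z.presheaf.map (homOfLE (ZH_mono ι ⟨G, hx⟩)).op (evalAway ι H a) := by
  rw [evalAway_apply, evalAway_apply]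
  have h1 := congrArg (fun φ => φ.hom a) (Proj.awayMap_awayToSection (grading A r) hG hx (f := H))
  simp only [CommRingCat.hom_comp, RingHom.coe_comp, Function.comp_apply, CommRingCat.hom_ofHom] at h1
  rw [h1]
  have hnat := ι.naturality (homOfLE (Proj.basicOpen_mono (grading A r) _ _ (⟨G, hx⟩ : H ∣ H'))).op
  have h2 := congrArg (fun φ => φ.hom (Proj.awayToSection (grading A r) H a)) hnat
  simp only [CommRingCat.hom_comp, RingHom.coe_comp, Function.comp_apply] at h2
  exact h2

/-- **`evalAway` is surjective for a closed immersion** and `H` homogeneous of positive degree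
(`Γ(𝐏, D₊(H)) = (A[x]_{(H)})₀` and `ι^*` is onto over the affine `D₊(H)`). [folklore] -/
theorem evalAway_surjective [IsClosedImmersion ι] {m : ℕ} {H : MvPolynomial (Fin (r + 1)) A}
    (hH : H ∈ grading A r m) (hm : 0 < m) : Function.Surjective (evalAway ι H) := by
  intro y
  obtain ⟨t, ht⟩ := ι.app_surjective _ (Proj.isAffineOpen_basicOpen _ _ hH hm) y
  obtain ⟨b, hb⟩ := (ConcreteCategory.bijective_of_isIso
    (Proj.basicOpenIsoAway (grading A r) H hH hm).hom).2 t
  exact ⟨b, by rw [evalAway_apply, ← ht, ← hb]; rfl⟩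

/-! ### `D₊(fg)` as the basic open of the section of `g^{deg f}/f^{deg g}` over `D₊(f)` -/

section AwayChart

variable {d : ℕ} {f : MvPolynomial (Fin (r + 1)) A} (hf : f ∈ grading A r d) (hd : 0 < d)

include hd

/-- Restriction from `Γ(𝐏, D₊(f))` to the chart `Γ(Spec (A[x]_{(f)})₀, ⊤)` (`topIso` then pull-back
along `basicOpenIsoSpec⁻¹`), for general homogeneous `f` of positive degree (the sibling
`ProjCech.resChart` is the case of a monomial). [folklore] -/
def resAway : Γ(PP A r, Proj.basicOpen (grading A r) f) ⟶
    Γ(Spec (CommRingCat.of (Away (grading A r) f)), ⊤) :=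
  (Proj.basicOpen (grading A r) f).topIso.inv ≫ (Proj.basicOpenIsoSpec (grading A r) f hf hd).inv.appTop

/-- Pulling back `awayToSection b` to the chart gives `b` (through `Γ(Spec B, ⊤) ≅ B`). [folklore] -/
theorem resAway_awayToSection (b : Away (grading A r) f) :
    resAway hf hd (Proj.awayToSection (grading A r) f b) =
      (Scheme.ΓSpecIso (.of (Away (grading A r) f))).inv b := by
  rw [resAway, CategoryTheory.ConcreteCategory.comp_apply]
  have h3 : (Proj.basicOpen (grading A r) f).topIso.inv (Proj.awayToSection (grading A r) f b) =
      (Proj.basicOpenIsoSpec (grading A r) f hf hd).hom.appTop ((Scheme.ΓSpecIso (.of _)).inv b) := by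
    rw [Proj.basicOpenIsoSpec_hom, Scheme.Hom.appTop, Proj.basicOpenToSpec_app_top]
    simp only [CategoryTheory.ConcreteCategory.comp_apply]
    rw [CategoryTheory.Iso.inv_hom_id_apply]
  rw [h3, ← CategoryTheory.ConcreteCategory.comp_apply, ← Scheme.Hom.comp_appTop, Iso.inv_hom_id,
    Scheme.Hom.id_appTop]
  rfl

/-- The chart lands in `D₊(f)`: its preimage is everything. [folklore] -/
theorem awayι_preimage_basicOpen_self :
    Proj.awayι (grading A r) f hf hd ⁻¹ᵁ Proj.basicOpen (grading A r) f = ⊤ := by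
  rw [← Proj.opensRange_awayι (grading A r) f hf hd]
  exact Scheme.Hom.preimage_opensRange _

/-- Restriction to the chart through `appLE` is `resAway`. [folklore] -/
theorem appLE_awayι_eq_resAway :
    (Proj.awayι (grading A r) f hf hd).appLE (Proj.basicOpen (grading A r) f) ⊤
        (awayι_preimage_basicOpen_self hf hd).ge = resAway hf hd := by
  have htop : ⊤ ≤ (Proj.basicOpen (grading A r) f).ι ⁻¹ᵁ Proj.basicOpen (grading A r) f := by
    rw [Scheme.Opens.ι_preimage_self]
  have h2 : (Proj.basicOpen (grading A r) f).ι.appLE (Proj.basicOpen (grading A r) f) ⊤ htop =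
      (Proj.basicOpen (grading A r) f).topIso.inv := by
    rw [Scheme.Opens.ι_appLE, Scheme.Opens.topIso_inv]
    exact congrArg (fun q ↦ (PP A r).presheaf.map (Quiver.Hom.op q)) (Subsingleton.elim _ _)
  have h := Scheme.Hom.appLE_comp_appLE (Proj.basicOpenIsoSpec (grading A r) f hf hd).inv
    (Proj.basicOpen (grading A r) f).ι (Proj.basicOpen (grading A r) f) ⊤ ⊤ htop le_top
  rw [h2] at h
  rw [resAway, Scheme.Hom.appTop, Scheme.Hom.app_eq_appLE]
  exact h.symm

/-- Restriction to the chart is injective (it is an isomorphism). [folklore] -/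
theorem resAway_injective : Function.Injective (resAway hf hd) := by
  rw [resAway]
  exact (appTop_inv_injective (Proj.basicOpenIsoSpec (grading A r) f hf hd)).comp
    (ConcreteCategory.bijective_of_isIso (Proj.basicOpen (grading A r) f).topIso.inv).1

/-- Restricting a global function to the chart is pulling it back along the chart. [folklore] -/
theorem resAway_map_appTop (y : Γ(PP A r, ⊤)) :
    resAway hf hd ((PP A r).presheaf.map (homOfLE (le_top : Proj.basicOpen (grading A r) f ≤ ⊤)).op y) =
      (Proj.awayι (grading A r) f hf hd).appTop y := by
  have h : (PP A r).presheaf.map (homOfLE (le_top : Proj.basicOpen (grading A r) f ≤ ⊤)).op ≫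
      resAway hf hd = (Proj.awayι (grading A r) f hf hd).appTop := by
    rw [resAway, ← Proj.basicOpenIsoSpec_inv_ι, Scheme.Hom.comp_appTop, Scheme.Opens.ι_appTop,
      Scheme.Opens.topIso_inv, ← Category.assoc]
    congr 1
  rw [← CategoryTheory.ConcreteCategory.comp_apply, h]

include hf in
/-- **The `A`-structure of `Γ(𝐏, D₊(f))` on the chart**: the global function `a ∈ A` restricted to
`D₊(f)` is `awayToSection` of `a / 1 ∈ (A[x]_{(f)})₀`. [folklore] -/
theorem map_appTop_toSpec_eq_awayToSection_algebraMap (a : A) :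
    (PP A r).presheaf.map (homOfLE (le_top : Proj.basicOpen (grading A r) f ≤ ⊤)).op
        ((toSpec A r).appTop ((Scheme.ΓSpecIso (.of A)).inv a)) =
      Proj.awayToSection (grading A r) f (algebraMap A (Away (grading A r) f) a) := by
  apply resAway_injective hf hd
  rw [resAway_awayToSection, resAway_map_appTop, ← CategoryTheory.ConcreteCategory.comp_apply,
    ← Scheme.Hom.comp_appTop]
  have h2 : Proj.awayι (grading A r) f hf hd ≫ toSpec A r =
      Spec.map (CommRingCat.ofHom (algebraMap A (Away (grading A r) f))) :=
    Motives.ProjBaseChangeRing.awayι_projToSpec (Fin (r + 1)) hf hd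
  rw [h2, ← CategoryTheory.ConcreteCategory.comp_apply, ← Scheme.ΓSpecIso_inv_naturality]
  rfl

include hf in
/-- **`evalAway` on constants**: `evalAway f (a/1)` is the global function `a` of `Z` (pulled back
from `Spec A` along `Z → 𝐏 → Spec A`) restricted to `Z_f`. [folklore] -/
theorem evalAway_algebraMap (a : A) :
    evalAway ι f (algebraMap A (Away (grading A r) f) a) =
      Z.presheaf.map (homOfLE (le_top : ZH ι f ≤ ⊤)).op
        ((ι ≫ toSpec A r).appTop ((Scheme.ΓSpecIso (.of A)).inv a)) := by
  rw [evalAway_apply, ← map_appTop_toSpec_eq_awayToSection_algebraMap hf hd]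
  conv_rhs => rw [Scheme.Hom.comp_appTop, CategoryTheory.ConcreteCategory.comp_apply]
  have hnat := ι.naturality (homOfLE (le_top : Proj.basicOpen (grading A r) f ≤ ⊤)).op
  have key := congr_arg (fun φ => φ.hom ((toSpec A r).appTop ((Scheme.ΓSpecIso (.of A)).inv a))) hnat
  simp only [CommRingCat.hom_comp, RingHom.coe_comp, Function.comp_apply] at key
  exact key

variable {e : ℕ} {g : MvPolynomial (Fin (r + 1)) A} (hg : g ∈ grading A r e) (he : 0 < e)

include he

/-- **`D₊(fg)` is the basic open in `𝐏` of the section `awayToSection (g^{deg f}/f^{deg g})` over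
`D₊(f)`** (Mathlib `Proj.awayι_preimage_basicOpen` read back in `𝐏`). [folklore] -/
theorem basicOpen_mul_eq_basicOpen_awayToSection :
    Proj.basicOpen (grading A r) (f * g) = (PP A r).basicOpen (Proj.awayToSection (grading A r) f
      (Away.isLocalizationElem hf hg)) := by
  set t := Away.isLocalizationElem hf hg with ht
  set z := Proj.awayToSection (grading A r) f t with hz
  have hle₁ : Proj.basicOpen (grading A r) (f * g) ≤ (Proj.awayι (grading A r) f hf hd).opensRange := by
    rw [Proj.opensRange_awayι]; exact Proj.basicOpen_mono _ _ _ ⟨g, rfl⟩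
  have hle₂ : (PP A r).basicOpen z ≤ (Proj.awayι (grading A r) f hf hd).opensRange := by
    rw [Proj.opensRange_awayι]; exact (PP A r).basicOpen_le _
  have h1 : Proj.awayι (grading A r) f hf hd ⁻¹ᵁ Proj.basicOpen (grading A r) (f * g) =
      PrimeSpectrum.basicOpen t := by
    rw [Proj.basicOpen_mul, Scheme.Hom.preimage_inf, awayι_preimage_basicOpen_self, top_inf_eq,
      Proj.awayι_preimage_basicOpen (grading A r) (f_deg := hf) (g_deg := hg) (hm' := he)]
  have h2' : (Spec (CommRingCat.of (Away (grading A r) f))).presheaf.map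
      (homOfLE (awayι_preimage_basicOpen_self hf hd).ge).op
        ((Proj.awayι (grading A r) f hf hd).app (Proj.basicOpen (grading A r) f) z) =
        (Scheme.ΓSpecIso (.of (Away (grading A r) f))).inv t := by
    change (Proj.awayι (grading A r) f hf hd).appLE (Proj.basicOpen (grading A r) f) ⊤
      (awayι_preimage_basicOpen_self hf hd).ge z = _
    rw [appLE_awayι_eq_resAway, hz, resAway_awayToSection]
  have h2 : Proj.awayι (grading A r) f hf hd ⁻¹ᵁ (PP A r).basicOpen z = PrimeSpectrum.basicOpen t := by
    rw [Scheme.preimage_basicOpen]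
    have := (Spec (CommRingCat.of (Away (grading A r) f))).basicOpen_res
      ((Proj.awayι (grading A r) f hf hd).app (Proj.basicOpen (grading A r) f) z)
      (homOfLE (awayι_preimage_basicOpen_self hf hd).ge).op
    rw [top_inf_eq, h2', basicOpen_eq_of_affine] at this
    exact this.symm
  calc Proj.basicOpen (grading A r) (f * g)
      = Proj.awayι (grading A r) f hf hd ''ᵁ Proj.awayι (grading A r) f hf hd ⁻¹ᵁ
          Proj.basicOpen (grading A r) (f * g) := by
        rw [Scheme.Hom.image_preimage_eq_opensRange_inf, inf_eq_right.mpr hle₁]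
    _ = Proj.awayι (grading A r) f hf hd ''ᵁ Proj.awayι (grading A r) f hf hd ⁻¹ᵁ (PP A r).basicOpen z := by
        rw [h1, h2]
    _ = _ := by rw [Scheme.Hom.image_preimage_eq_opensRange_inf, inf_eq_right.mpr hle₂]

/-- **`Z_{fg}` is the basic open in `Z` of the section `evalAway f (g^{deg f}/f^{deg g})`.**
[folklore] -/
theorem ZH_mul_eq_basicOpen_evalAway :
    ZH ι (f * g) = Z.basicOpen (evalAway ι f (Away.isLocalizationElem hf hg)) := by
  rw [evalAway_apply, ← Scheme.preimage_basicOpen,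
    ← basicOpen_mul_eq_basicOpen_awayToSection hf hd hg he]

end AwayChart

/-! ### Rational functions of fractions -/

variable [IsIntegral Z]

/-- **The rational function of a degree-zero fraction with denominator a power of `H`**, for
`Z_H ≠ ∅`: the germ at the generic point of `evalAway`. [folklore] -/
def fracFn (H : MvPolynomial (Fin (r + 1)) A) (hne : genericPoint Z ∈ ZH ι H) :
    Away (grading A r) H →+* Z.functionField :=
  (Z.presheaf.germ (ZH ι H) (genericPoint Z) hne).hom.comp (evalAway ι H)

/-- `fracFn` is the rational function of the section `evalAway`. [folklore] -/
theorem fracFn_apply (H : MvPolynomial (Fin (r + 1)) A) (hne : genericPoint Z ∈ ZH ι H)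
    (a : Away (grading A r) H) : fracFn ι H hne a = ofSection hne (evalAway ι H a) := rfl

/-- **Independence of the chart**: for `H' = H G`, the rational function of `awayMap a` (denominator
`H'`) is that of `a` (denominator `H`). [folklore] -/
theorem fracFn_awayMap {H G H' : MvPolynomial (Fin (r + 1)) A} {m' : ℕ} (hG : G ∈ grading A r m')
    (hx : H' = H * G) (hne' : genericPoint Z ∈ ZH ι H') (a : Away (grading A r) H) :
    fracFn ι H' hne' (awayMap (grading A r) hG hx a) = fracFn ι H (ZH_mono ι ⟨G, hx⟩ hne') a := by
  rw [fracFn_apply, fracFn_apply, evalAway_awayMap ι hG hx, ofSection_map]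

/-- The rational function of a fraction with denominator `H^m` is regular on `Z_H`. [folklore] -/
theorem isRegularAt_fracFn (H : MvPolynomial (Fin (r + 1)) A) {z : Z} (hz : z ∈ ZH ι H)
    (a : Away (grading A r) H) :
    IsRegularAt z (fracFn ι H (genericPoint_mem_of_mem hz) a) :=
  isRegularAt_ofSection hz _

/-- **On `Z_{fg} = Z_f ∩ Z_g` the fraction `g^{deg f}/f^{deg g}` is a unit.** [folklore] -/
theorem isUnitAt_fracFn_isLocalizationElem {d : ℕ} {f : MvPolynomial (Fin (r + 1)) A}
    (hf : f ∈ grading A r d) (hd : 0 < d) {e : ℕ} {g : MvPolynomial (Fin (r + 1)) A}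
    (hg : g ∈ grading A r e) (he : 0 < e) {z : Z} (hz : z ∈ ZH ι (f * g)) :
    IsUnitAt z (fracFn ι f (genericPoint_mem_of_mem ((ZH_mono ι ⟨g, rfl⟩) hz))
      (Away.isLocalizationElem hf hg)) := by
  rw [fracFn_apply, isUnitAt_ofSection_iff ((ZH_mono ι ⟨g, rfl⟩) hz),
    ← ZH_mul_eq_basicOpen_evalAway ι hf hd hg he]
  exact hz

/-- **Every rational function regular on `Z_H` is a fraction with denominator a power of `H`**, for
`ι` a closed immersion and `H` homogeneous of positive degree (`Γ(Z_H, 𝒪_Z)` is the image of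
`(A[x]_{(H)})₀`). [folklore] -/
theorem exists_fracFn_eq_of_forall_isRegularAt [IsClosedImmersion ι] {m : ℕ}
    {H : MvPolynomial (Fin (r + 1)) A} (hH : H ∈ grading A r m) (hm : 0 < m)
    (hne : genericPoint Z ∈ ZH ι H) {φ : Z.functionField} (hφ : ∀ z ∈ ZH ι H, IsRegularAt z φ) :
    ∃ a, fracFn ι H hne a = φ := by
  obtain ⟨a, ha⟩ := evalAway_surjective ι hH hm (sectionOf hne φ hφ)
  exact ⟨a, by rw [fracFn_apply, ha, ofSection_sectionOf]⟩

/-! ### Dehomogenisation at a coordinate `x_{j₀}` with `Z ⊄ V(x_{j₀})` -/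

section Dehom

omit [IsIntegral Z]

variable (A r) in
/-- **Dehomogenisation `x_{j₀} := 1` as a ring homomorphism `A[x] → (A[x]_{(x_{j₀})})₀`**,
`x_i ↦ x_i/x_{j₀}`: the composite of the tree's `ProjectiveSpace.dehomogenize` (`x_{j₀} := 1`,
`Motives/VarietiesProjectiveSpaceProofs`) and `ProjectiveSpace.toChart` (`y ↦ x/x_{j₀}`).
[folklore] -/
def dehomAway (j₀ : Fin (r + 1)) : MvPolynomial (Fin (r + 1)) A →+* Away (grading A r) (MvPolynomial.X j₀) :=
  (ProjectiveSpace.toChart A j₀).toRingHom.comp (ProjectiveSpace.dehomogenize A j₀).toRingHom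

/-- `dehomAway j₀ G = G / x_{j₀}^b` for `G` homogeneous of degree `b`
(`ProjectiveSpace.toChart_dehomogenize`, `Motives/HypersurfaceChartAlgebra`). [folklore] -/
theorem dehomAway_of_mem (j₀ : Fin (r + 1)) {b : ℕ} {G : MvPolynomial (Fin (r + 1)) A}
    (hG : G ∈ grading A r b) :
    dehomAway A r j₀ G = Away.mk (grading A r) (ProjectiveSpace.X_mem j₀) b G (by simpa using hG) :=
  ProjectiveSpace.toChart_dehomogenize j₀ G hG

/-- `dehomAway` on constants is the structure map. [folklore] -/
theorem dehomAway_C (j₀ : Fin (r + 1)) (a : A) :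
    dehomAway A r j₀ (MvPolynomial.C a) = algebraMap A (Away (grading A r) (MvPolynomial.X j₀)) a := by
  rw [dehomAway, RingHom.comp_apply, AlgHom.toRingHom_eq_coe, AlgHom.toRingHom_eq_coe,
    RingHom.coe_coe, RingHom.coe_coe, ← MvPolynomial.algebraMap_eq, AlgHom.commutes, AlgHom.commutes]

end Dehom

/-! ### Rational functions of homogeneous polynomials relative to `x_{j₀}` -/

section DehomFn

variable (j₀ : Fin (r + 1)) (hj₀ : genericPoint Z ∈ ZH ι (MvPolynomial.X j₀))

/-- **The rational function `G(x/x_{j₀})` of a polynomial `G`**: dehomogenise at `x_{j₀}` and take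
the rational function of the resulting degree-zero fraction (requires `Z ⊄ V(x_{j₀})`). A ring
homomorphism `A[x] → K(Z)`; on a homogeneous `G` of degree `b` it is the rational function of
`G/x_{j₀}^b` (`dehomFn_of_mem`). [folklore] -/
def dehomFn : MvPolynomial (Fin (r + 1)) A →+* Z.functionField :=
  (fracFn ι (MvPolynomial.X j₀) hj₀).comp (dehomAway A r j₀)

/-- `dehomFn` on a homogeneous polynomial. [folklore] -/
theorem dehomFn_of_mem {b : ℕ} {G : MvPolynomial (Fin (r + 1)) A} (hG : G ∈ grading A r b) :
    dehomFn ι j₀ hj₀ G = fracFn ι (MvPolynomial.X j₀) hj₀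
      (Away.mk (grading A r) (ProjectiveSpace.X_mem j₀) b G (by simpa using hG)) := by
  rw [dehomFn, RingHom.comp_apply, dehomAway_of_mem j₀ hG]

variable {j₀}

/-- **Comparison of charts**: for `H` homogeneous of degree `δ > 0` with `Z ⊄ V(H)` and `G`
homogeneous of degree `mδ`, the rational function of `G/H^m` times that of `H(x/x_{j₀})^m` is that of
`G(x/x_{j₀})` — all three are read in the common chart `D₊(H x_{j₀})`. [folklore] -/
theorem fracFn_mk_mul_dehomFn_pow {δ : ℕ} {H : MvPolynomial (Fin (r + 1)) A}
    (hH : H ∈ grading A r δ) (hne : genericPoint Z ∈ ZH ι H) (m : ℕ)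
    {G : MvPolynomial (Fin (r + 1)) A} (hG : G ∈ grading A r (m • δ)) :
    fracFn ι H hne (Away.mk (grading A r) hH m G hG) * dehomFn ι j₀ hj₀ H ^ m =
      dehomFn ι j₀ hj₀ G := by
  -- the common chart `x = H * x_{j₀}`
  have hx' : H * MvPolynomial.X j₀ = MvPolynomial.X j₀ * H := mul_comm _ _
  have hneX : genericPoint Z ∈ ZH ι (H * MvPolynomial.X j₀) := by
    rw [ZH_mul]; exact ⟨hne, hj₀⟩
  have hGδ : G ∈ grading A r (m * δ) := by simpa using hG
  rw [dehomFn_of_mem ι j₀ hj₀ hH, dehomFn_of_mem ι j₀ hj₀ hGδ,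
    ← fracFn_awayMap ι (ProjectiveSpace.X_mem j₀) rfl hneX, ← fracFn_awayMap ι hH hx' hneX,
    ← fracFn_awayMap ι hH hx' hneX, ← map_pow, ← map_mul]
  congr 1
  apply HomogeneousLocalization.val_injective
  simp only [HomogeneousLocalization.val_mul, HomogeneousLocalization.val_pow, awayMap_mk,
    Away.val_mk, Localization.mk_pow, Localization.mk_mul]
  rw [Localization.mk_eq_mk_iff, Localization.r_iff_exists]
  refine ⟨1, ?_⟩
  simp only [OneMemClass.coe_one, one_mul, Submonoid.coe_mul, SubmonoidClass.coe_pow]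
  ring

/-- **`H(x/x_{j₀}) ≠ 0` in `K(Z)` when `Z ⊄ V(H)`** (it is a unit at the points of
`Z_H ∩ Z_{x_{j₀}} ≠ ∅`). [folklore] -/
theorem dehomFn_ne_zero {δ : ℕ} {H : MvPolynomial (Fin (r + 1)) A} (hH : H ∈ grading A r δ)
    (hδ : 0 < δ) (hne : genericPoint Z ∈ ZH ι H) : dehomFn ι j₀ hj₀ H ≠ 0 := by
  have hgen : genericPoint Z ∈ ZH ι (MvPolynomial.X j₀ * H) := by rw [ZH_mul]; exact ⟨hj₀, hne⟩
  have hu := isUnitAt_fracFn_isLocalizationElem ι (ProjectiveSpace.X_mem j₀) one_pos hH hδ hgen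
  have heq : Away.isLocalizationElem (ProjectiveSpace.X_mem (R := A) j₀) hH =
      Away.mk (grading A r) (ProjectiveSpace.X_mem j₀) δ H (by simpa using hH) := by
    rw [ProjectiveSpace.isLocalizationElem_X, ProjectiveSpace.toChart_dehomogenize j₀ H hH]
  rw [dehomFn_of_mem ι j₀ hj₀ hH, ← heq]
  exact hu.ne_zero

/-- **The kernel of `G/H^m ↦` its rational function**: for `G` homogeneous of degree `mδ`, the
rational function of `G/H^m` vanishes iff `G(x/x_{j₀}) = 0` in `K(Z)`. [folklore] -/
theorem fracFn_mk_eq_zero_iff {δ : ℕ} {H : MvPolynomial (Fin (r + 1)) A}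
    (hH : H ∈ grading A r δ) (hδ : 0 < δ) (hne : genericPoint Z ∈ ZH ι H) (m : ℕ)
    {G : MvPolynomial (Fin (r + 1)) A} (hG : G ∈ grading A r (m • δ)) :
    fracFn ι H hne (Away.mk (grading A r) hH m G hG) = 0 ↔ dehomFn ι j₀ hj₀ G = 0 := by
  have key := fracFn_mk_mul_dehomFn_pow ι hj₀ hH hne m hG
  have hH0 := pow_ne_zero m (dehomFn_ne_zero ι hj₀ hH hδ hne)
  constructor
  · intro h; rw [← key, h, zero_mul]
  · intro h
    rw [h] at key
    exact (mul_eq_zero.1 key).resolve_right hH0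

/-- The rational function of `G/H^m` in terms of `dehomFn`: `G(x/x_{j₀}) / H(x/x_{j₀})^m`.
[folklore] -/
theorem fracFn_mk_eq_div {δ : ℕ} {H : MvPolynomial (Fin (r + 1)) A}
    (hH : H ∈ grading A r δ) (hδ : 0 < δ) (hne : genericPoint Z ∈ ZH ι H) (m : ℕ)
    {G : MvPolynomial (Fin (r + 1)) A} (hG : G ∈ grading A r (m • δ)) :
    fracFn ι H hne (Away.mk (grading A r) hH m G hG) =
      dehomFn ι j₀ hj₀ G / dehomFn ι j₀ hj₀ H ^ m := by
  rw [eq_div_iff (pow_ne_zero m (dehomFn_ne_zero ι hj₀ hH hδ hne))]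
  exact fracFn_mk_mul_dehomFn_pow ι hj₀ hH hne m hG

end DehomFn

end ProjFrac

end Literature.AlgebraicGeometry.Motives

end
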